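import Summits.PneNP.PneNP.Cruxes.FoolingMeasure.CriticalSupport

/-!
# FoolingMeasure (stmt-PneNP-19727) — crux-ideate round 2, seat 1, gen 16: typed first lemmas of three idea cards

FRONTIER restricted-model rung (AEA cut rectangles vs NON-3-COL); nothing here bears on `P ≠ NP`.
Cards (crux `Summit.PneNP.PneNP.Theses.AeaCutRectangles.FoolingMeasure` = X1, route-PneNP-AeaCutRectangles):

* `critical-exchange-class` — μ := uniform measure on the generic class of 4-edge-critical, degree-bounded, half-dense edge
  sets (`InCritClass`, `critClass`, `uniformOn`); first rung `ClassBobSpread` (no Bob side is popular in the class) and the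
  matching necessary condition `BobPointMassBound` (any measure satisfying X1's rectangle clause has Bob-side point masses ≤ δ).
* `sparse-or-rigid-cut` — KILL side: `AliceBoxRigid`/`BobBoxRigid` (EXT/PROP of a half = few palette boxes), `HasCheapCut`, the
  structural dichotomy `SparseOrRigid` (every large 4-critical graph has a near-balanced cut that is sparse or box-rigid), the kill
  rung `SparseOrRigidKills : SparseOrRigid → ¬X1` (provable from p558563/CriticalSupport + `RigidityRectDark`); R9 typed.
* `light-kernel-mixing` — the proof mechanism for class measures: a dark rectangle is a biclique-free pair of the member × member
  LIGHT kernel (`Light`); `bicliqueFree_card_le_of_mixing` (abstract expander-mixing ⇒ |S ∩ T| ≤ λ·M/d, stated) and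
  `FoolingMeasureOfClassMixing` (mixing at precision λ/d ≤ δ on the class ⇒ X1).

Everything is a `def … : Prop` (statements, not proofs) except small helper definitions; `lean check` rc 0, no `sorry`.
-/

set_option linter.dupNamespace false
set_option autoImplicit false

namespace Summit.PneNP.PneNP.Cruxes.FoolingMeasure.IdeasR2s1g16

open Finset
open Summit.PneNP.PneNP.Theorems.AeaCutRectanglesDutyRectangles
open Summit.PneNP.PneNP.Cruxes.FoolingMeasure.CriticalSupport (IsEdgeCritical)

/-! ## Shared vocabulary -/

/-- `B` is a near-balanced cut of `Fin n` at tolerance `ε`. -/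
def NearBalanced (ε : ℝ) {n : ℕ} (B : Finset (Fin n)) : Prop :=
  (1 / 2 - ε) * (n : ℝ) ≤ B.card ∧ (B.card : ℝ) ≤ (1 / 2 + ε) * n

/-- X1's mass threshold `2^{-(n/2)·log₂ n − C·n}`. -/
noncomputable def delta (C n : ℕ) : ℝ :=
  (2 : ℝ) ^ (-((n : ℝ) / 2 * Real.logb 2 n) - (C : ℝ) * n)

/-- X1's rectangle clause for a weight `μ` at size `n`, tolerance `ε`, constant `C` (verbatim from the route statement). -/
def RectClause {n : ℕ} (μ : Finset (Sym2 (Fin n)) → ℝ) (ε : ℝ) (C : ℕ) : Prop :=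
  ∀ B : Finset (Fin n), (1 / 2 - ε) * (n : ℝ) ≤ B.card → (B.card : ℝ) ≤ (1 / 2 + ε) * n →
    ∀ 𝓐 𝓑 : Finset (Finset (Sym2 (Fin n))),
      (∀ α ∈ 𝓐, ∀ e ∈ α, ¬ e.IsDiag ∧ ∃ v ∈ e, v ∉ B) →
      (∀ β ∈ 𝓑, ∀ e ∈ β, ¬ e.IsDiag ∧ ∀ v ∈ e, v ∈ B) →
      (∀ α ∈ 𝓐, ∀ β ∈ 𝓑,
        ¬ (SimpleGraph.fromEdgeSet ((α ∪ β : Finset (Sym2 (Fin n))) : Set (Sym2 (Fin n)))).Colorable 3) →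
      ∑ q ∈ 𝓐 ×ˢ 𝓑, μ (q.1 ∪ q.2) ≤ delta C n

/-- A weight is a loopless NON-3-COL probability weight (X1's support conditions). -/
def IsNon3ColWeight {n : ℕ} (μ : Finset (Sym2 (Fin n)) → ℝ) : Prop :=
  (∀ S, 0 ≤ μ S) ∧ (∑ S, μ S = 1) ∧
    ∀ S, μ S ≠ 0 → (∀ e ∈ S, ¬ e.IsDiag) ∧ ¬ (SimpleGraph.fromEdgeSet (S : Set (Sym2 (Fin n)))).Colorable 3

/-- Number of edges of `S` inside `B` (Bob's inner edge count). -/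
def innerEdges {n : ℕ} (S : Finset (Sym2 (Fin n))) (B : Finset (Fin n)) : ℕ :=
  (bobSide B S).card

/-- Every vertex of `Fin n` meets at most `Δ` edges of `S`. -/
def MaxDegreeLE {n : ℕ} (S : Finset (Sym2 (Fin n))) (Δ : ℕ) : Prop :=
  ∀ v : Fin n, (S.filter fun e => v ∈ e).card ≤ Δ

/-! ## Card 1 — `critical-exchange-class` -/

/-- The GENERIC CRITICAL CLASS `𝒞_n(d, Δ, η, ε)`: 4-edge-critical (hence loopless, not 3-colourable, K₄-free for n > 4),
`d·n/2` edges, maximum degree `≤ Δ`, and every near-balanced `B` spans more than `(1+η)|B|` inner edges. -/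
def InCritClass {n : ℕ} (d Δ : ℕ) (η ε : ℝ) (S : Finset (Sym2 (Fin n))) : Prop :=
  IsEdgeCritical S ∧ 2 * S.card = d * n ∧ MaxDegreeLE S Δ ∧
    ∀ B : Finset (Fin n), NearBalanced ε B → (1 + η) * (B.card : ℝ) < innerEdges S B

/-- The class as a finite family. -/
noncomputable def critClass (n d Δ : ℕ) (η ε : ℝ) : Finset (Finset (Sym2 (Fin n))) := by
  classical exact Finset.univ.filter (InCritClass d Δ η ε)

/-- The uniform weight on a finite family of edge sets. -/
noncomputable def uniformOn {n : ℕ} (F : Finset (Finset (Sym2 (Fin n)))) : Finset (Sym2 (Fin n)) → ℝ := by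
  classical exact fun S => if S ∈ F then ((F.card : ℝ))⁻¹ else 0

/-- FIRST RUNG of the card (construct side): the class is non-empty infinitely often and NO BOB SIDE IS POPULAR in it —
for every near-balanced `B` and every inner graph `β₀`, at most a `δ`-fraction of the class has Bob side exactly `β₀`.
(Necessary for X1 on `uniformOn (critClass …)` by `BobPointMassBound`; it is the min-entropy form of the half-density clause.) -/
def ClassBobSpread (d Δ : ℕ) (η : ℝ) : Prop :=
  ∃ ε : ℝ, 0 < ε ∧ ε ≤ 1 / 4 ∧ ∀ C : ℕ, ∃ᶠ n in Filter.atTop,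
    (critClass n d Δ η ε).Nonempty ∧
    ∀ B : Finset (Fin n), NearBalanced ε B → ∀ β₀ : Finset (Sym2 (Fin n)),
      (((critClass n d Δ η ε).filter fun S => bobSide B S = β₀).card : ℝ) ≤ delta C n * (critClass n d Δ η ε).card

/-- NECESSARY CONDITION (provable from the rectangle clause with `𝓑 = {β₀}`, `𝓐 = {aliceSide B G : bobSide B G = β₀}`):
every weight satisfying X1's clause puts mass `≤ δ` on each single Bob side. -/
def BobPointMassBound : Prop :=
  ∀ (n : ℕ) (μ : Finset (Sym2 (Fin n)) → ℝ) (ε : ℝ) (C : ℕ), IsNon3ColWeight μ → RectClause μ ε C →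
    ∀ B : Finset (Fin n), NearBalanced ε B → ∀ β₀ : Finset (Sym2 (Fin n)),
      (∑ G ∈ (Finset.univ.filter fun G => bobSide B G = β₀), μ G) ≤ delta C n

/-- The card's thesis for X1: the uniform weight on the generic critical class fools every near-balanced cut rectangle. -/
def ClassFools (d Δ : ℕ) (η : ℝ) : Prop :=
  ∃ ε : ℝ, 0 < ε ∧ ε ≤ 1 / 4 ∧ ∀ C : ℕ, ∃ᶠ n in Filter.atTop,
    (critClass n d Δ η ε).Nonempty ∧ RectClause (uniformOn (critClass n d Δ η ε)) ε C

/-- `ClassFools ⇒ X1` (the uniform weight on a non-empty class of critical sets is a loopless NON-3-COL probability weight). -/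
def ClassFoolsImpliesX1 (d Δ : ℕ) (η : ℝ) : Prop :=
  ClassFools d Δ η → Summit.PneNP.PneNP.Theses.AeaCutRectangles.FoolingMeasure

/-! ## Card 2 — `sparse-or-rigid-cut` (kill side: the cheap-cut dichotomy for 4-critical graphs) -/

/-- `EXT_B(α)`: the colourings whose restriction to `B` extends to an `α`-proper colouring (a cylinder set over `B`). -/
def extSet {n : ℕ} (B : Finset (Fin n)) (α : Finset (Sym2 (Fin n))) : Set (Fin n → Fin 3) :=
  {c | ∃ c' : Fin n → Fin 3, (∀ v ∈ B, c' v = c v) ∧ c' ∉ killSet α}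

/-- The colour-symmetric PALETTE BOX on `B` with forbidden palettes `F`: `c` lies in it iff, after some permutation of the three
colours, `c v ∉ F v` for every `v ∈ B`.  One box is `3·|B|` bits of data. -/
def InBox {n : ℕ} (B : Finset (Fin n)) (F : Fin n → Finset (Fin 3)) (c : Fin n → Fin 3) : Prop :=
  ∃ π : Equiv.Perm (Fin 3), ∀ v ∈ B, π (c v) ∉ F v

/-- ALICE-BOX-RIGID at `B` with `L` boxes: `EXT_B` of Alice's side (inner-`A` edges and crossing edges) is EXACTLY a union of `≤ L`
palette boxes.  `L = 1` is the arc-sandwich situation (Alice's side uniquely colourable on `A` modulo interior breathers: R9 of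
ARC-SANDWICH-r2s1g13); interior freedom of Alice's side is invisible here — only the boundary behaviour enters `EXT_B`. -/
def AliceBoxRigid {n : ℕ} (L : ℕ) (B : Finset (Fin n)) (G : Finset (Sym2 (Fin n))) : Prop :=
  ∃ 𝓕 : Finset (Fin n → Finset (Fin 3)), 𝓕.card ≤ L ∧
    ∀ c : Fin n → Fin 3, c ∈ extSet B (aliceSide B G) ↔ ∃ F ∈ 𝓕, InBox B F c

/-- BOB-BOX-RIGID at `B` with `L` boxes: the Bob-proper colourings (a cylinder set over `B`) are exactly a union of `≤ L` palette
boxes (`L = 1`, `F v = {ξ v}ᶜ`: Bob's half uniquely 3-colourable). -/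
def BobBoxRigid {n : ℕ} (L : ℕ) (B : Finset (Fin n)) (G : Finset (Sym2 (Fin n))) : Prop :=
  ∃ 𝓕 : Finset (Fin n → Finset (Fin 3)), 𝓕.card ≤ L ∧
    ∀ c : Fin n → Fin 3, c ∉ killSet (bobSide B G) ↔ ∃ F ∈ 𝓕, InBox B F c

/-- The rigidity scale the refuter can afford: `L(n)` boxes cost `≤ 3n·L(n)` bits, below `(n/2)·log₂ n − n` once `L(n) = ⌊log₂ n⌋/8`. -/
def boxScale (n : ℕ) : ℕ := Nat.log 2 n / 8

/-- `G` has a CHEAP CUT at tolerance `ε`: a near-balanced `B` at which Bob's inner graph is SPARSE (`≤ n/2 − ε·n` edges: the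
sparse-fibre count `2^{(1/2−ε)n·log₂n+O(n)}` beats the budget) or one half is box-rigid at scale `L(n)` (the rigidity rectangle beats it). -/
def HasCheapCut (ε : ℝ) {n : ℕ} (G : Finset (Sym2 (Fin n))) : Prop :=
  ∃ B : Finset (Fin n), NearBalanced ε B ∧
    ((innerEdges G B : ℝ) ≤ n / 2 - ε * n ∨ AliceBoxRigid (boxScale n) B G ∨ BobBoxRigid (boxScale n) B G)

/-- THE KILL CRUX (structural graph theory, no measure): for every tolerance, every large enough 4-EDGE-CRITICAL graph has a cheap
cut.  Every half-dense critical family known to the cell (near-miss / cyclotomic circulants, DMP, normal cycle and height systems)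
has box-rigid interval cuts (arc sandwich); every flexible one (generic cores; the exchange-walk class at every bias, kit j313706 /
j313808) has sparse cuts by a wide margin (min near-half ≤ 0.35·|B| ≈ 0.17n). -/
def SparseOrRigid : Prop :=
  ∀ ε : ℝ, 0 < ε → ε ≤ 1 / 4 → ∀ᶠ n in Filter.atTop, ∀ G : Finset (Sym2 (Fin n)), IsEdgeCritical G → HasCheapCut ε G

/-- THE KILL RUNG (provable now from tree lemmas: `foolingMeasure_iff_crit` (WLOG critical supports), pigeonhole over `≤ 2^n` cuts
and three reasons, `bobFibre_le_of_rectClause` (p558563) with the count of sparse Bob sides, and the dark rectangles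
`{α : EXT_B α = Ψ} × {β : β kills Ψ}` / `{α : α kills P} × {β : PROP β = P}` indexed by `≤ 8^{n·L(n)}` box families): -/
def SparseOrRigidKills : Prop :=
  SparseOrRigid → ¬ Summit.PneNP.PneNP.Theses.AeaCutRectangles.FoolingMeasure

/-- The rigidity rectangle is dark (the one-line heart of the rung; provable): if every colouring in `EXT_B(α)` is killed by `β`
then `α ∪ β` is not 3-colourable. -/
def RigidityRectDark : Prop :=
  ∀ (n : ℕ) (B : Finset (Fin n)) (α β : Finset (Sym2 (Fin n))),
    (∀ c ∈ extSet B α, c ∈ killSet β) →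
    ¬ (SimpleGraph.fromEdgeSet ((α ∪ β : Finset (Sym2 (Fin n))) : Set (Sym2 (Fin n)))).Colorable 3

/-- … and its proof (Bob's side need not even lie inside `B`). -/
theorem rigidityRectDark : RigidityRectDark := by
  intro n B α β hkill
  rw [not_colorable_iff_forall_mem_killSet]
  intro c
  by_contra hc
  have hα : c ∉ killSet α := fun h => hc (killSet_mono Finset.subset_union_left h)
  have hext : c ∈ extSet B α := ⟨c, fun v _ => rfl, hα⟩
  exact hc (killSet_mono Finset.subset_union_right (hkill c hext))

/-- Conversely the rectangle CAPTURES every non-3-colourable member: Bob's side of `G` kills all of `EXT_B` of Alice's side of `G`. -/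
theorem bobSide_kills_extSet {n : ℕ} (B : Finset (Fin n)) (G : Finset (Sym2 (Fin n)))
    (hG : ¬ (SimpleGraph.fromEdgeSet (G : Set (Sym2 (Fin n)))).Colorable 3) :
    ∀ c ∈ extSet B (aliceSide B G), c ∈ killSet (bobSide B G) := by
  classical
  rintro c ⟨c', hc', hα⟩
  rw [not_colorable_iff_forall_mem_killSet] at hG
  -- `c'` agrees with `c` on `B`; Bob's edges lie inside `B`, so Bob kills `c` iff Bob kills `c'`.
  have hG' := hG c'
  rw [← aliceSide_union_bobSide B G] at hG'
  rcases mem_killSet_union hG' with h | h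
  · exact (hα h).elim
  · obtain ⟨e, he, hd, hm⟩ := h
    refine ⟨e, he, hd, ?_⟩
    have heB : ∀ v ∈ e, v ∈ B := (mem_bobSide.1 he).2
    induction e using Sym2.ind with
    | h a b =>
      rw [map_mk_isDiag_iff] at hm ⊢
      rw [← hc' a (heB a (Sym2.mem_mk_left a b)), ← hc' b (heB b (Sym2.mem_mk_right a b))]
      exact hm

/-- The members of positive weight whose Bob half at `B` is uniquely 3-colourable (`BobBoxRigid 1`). -/
noncomputable def rigidMembers {n : ℕ} (μ : Finset (Sym2 (Fin n)) → ℝ) (B : Finset (Fin n)) :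
    Finset (Finset (Sym2 (Fin n))) := by
  classical exact Finset.univ.filter fun G => μ G ≠ 0 ∧ BobBoxRigid 1 B G

/-- RIGID-HALF DUTY, the `L = 1` instance as a stand-alone lemma (R9 on Bob's side, typed): under X1's clause the members whose
Bob half is one palette box have total mass `≤ 8^{|B|}·δ` (one rectangle per box). -/
def UniqueBobSideMassBound : Prop :=
  ∀ (n : ℕ) (μ : Finset (Sym2 (Fin n)) → ℝ) (ε : ℝ) (C : ℕ), IsNon3ColWeight μ → RectClause μ ε C →
    ∀ B : Finset (Fin n), NearBalanced ε B →
      (∑ G ∈ rigidMembers μ B, μ G) ≤ (8 : ℝ) ^ B.card * delta C n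

/-! ## Card 3 — `light-kernel-mixing` -/

/-- The LIGHT kernel at cut `B`: Alice's side of `G` together with Bob's side of `G'` IS 3-colourable. -/
def Light {n : ℕ} (B : Finset (Fin n)) (G G' : Finset (Sym2 (Fin n))) : Prop :=
  (SimpleGraph.fromEdgeSet ((aliceSide B G ∪ bobSide B G' : Finset (Sym2 (Fin n))) : Set (Sym2 (Fin n)))).Colorable 3

/-- Number of light pairs between `S` and `T` for a kernel `L` on a finite index type. -/
noncomputable def lightPairs {ι : Type*} (L : ι → ι → Prop) (S T : Finset ι) : ℕ := by
  classical exact ((S ×ˢ T).filter fun p => L p.1 p.2).card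

/-- Two-sided EXPANDER-MIXING hypothesis for a kernel `L` with density parameter `d/M` and error `λ`. -/
def MixingBound {ι : Type*} [Fintype ι] (L : ι → ι → Prop) (d lam : ℝ) : Prop :=
  ∀ S T : Finset ι,
    |(lightPairs L S T : ℝ) - d * S.card * T.card / Fintype.card ι| ≤ lam * Real.sqrt ((S.card : ℝ) * T.card)

/-- ABSTRACT LEMMA (provable, a few lines of real arithmetic): under mixing, a pair `(S, T)` with NO light pair between them
has `|S ∩ T| ≤ √(|S||T|) ≤ λ·M/d`. -/
def BicliqueFreeCardLe : Prop :=
  ∀ (ι : Type) [Fintype ι] [DecidableEq ι] (L : ι → ι → Prop) (d lam : ℝ), 0 < d → MixingBound L d lam →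
    ∀ S T : Finset ι, lightPairs L S T = 0 → ((S ∩ T).card : ℝ) ≤ lam * Fintype.card ι / d

/-- CLASS MIXING at precision `δ`: on the generic critical class, at every near-balanced cut, the light kernel mixes with
`λ/d ≤ δ_C(n)`.  Square-root cancellation (λ ≈ 2√d for a random kernel of light-degree d = p·M) predicts this as soon as
`M = |𝒞_n| ≥ 4·n^n·4^{Cn}/p`; `|𝒞_n|` can be as large as `n^{(d/2 − o(1))n}`. -/
def ClassMixing (d Δ : ℕ) (η : ℝ) : Prop :=
  ∃ ε : ℝ, 0 < ε ∧ ε ≤ 1 / 4 ∧ ∀ C : ℕ, ∃ᶠ n in Filter.atTop,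
    (critClass n d Δ η ε).Nonempty ∧
    ∀ B : Finset (Fin n), NearBalanced ε B → ∃ dL lam : ℝ, 0 < dL ∧ lam / dL ≤ delta C n ∧
      MixingBound (fun G G' : ↥(critClass n d Δ η ε) => Light B G.1 G'.1) dL lam

/-- THE MECHANISM: class mixing ⇒ X1 (via `BicliqueFreeCardLe`: a dark rectangle meets the class in a biclique-free pair
`(S, T)` of the light kernel, and its mass under `uniformOn` is `|S ∩ T|/M ≤ λ/d ≤ δ`). -/
def FoolingMeasureOfClassMixing (d Δ : ℕ) (η : ℝ) : Prop :=
  ClassMixing d Δ η → Summit.PneNP.PneNP.Theses.AeaCutRectangles.FoolingMeasure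

end Summit.PneNP.PneNP.Cruxes.FoolingMeasure.IdeasR2s1g16
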